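import Mathlib
import HarnessLib
import Summits.AtomisticToContinuum.FouriersLaw.Theses.JunctionLocality
import Literature.MathematicalPhysics.KineticTheory.LangevinChainGibbs
import Summits.AtomisticToContinuum.FouriersLaw.Theorems.JunctionLocalitySuperadditiveResistanceStubTerminationLocalityAux4
import Summits.AtomisticToContinuum.FouriersLaw.Theorems.JunctionLocalitySuperadditiveResistanceKuboDirichlet

/-!
# Termination locality, exact fixed-`N` identity — part I: `L²` lifting across the junction
(stub `stub_terminationLocalityTC` of line `thermalise-then-cut-probe-insertion`, crux
`JunctionLocality.SuperadditiveResistance`, stmt-AtomisticToContinuum-11748)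

The exact termination identity (part III, `…TerminationIdentity.lean`) pairs the device's backward field
`gb₁∘R` with the source of the defect equation, `k_u = V'(q_N − q_{N−1}) · (∂_{p_{N−1}} g_N) ∘ π_N`
(`g_N` the bare `N`-piece's forward field, `π_N` the left-block map, `V'(r) = r + βr³` the FPU-β junction
force). The landed cross Green identity `Kubo.cross` needs `k_u ∈ L²(μ_T^{(N+M)})`, while the frames only
give `∂_{p_{N−1}} g_N ∈ L²(μ_T^{(N)})` (energy estimate at the γ-thermostatted end) and `V'` is unbounded.
This file supplies exactly that step, at fixed `N, M`:

* `junctionForce_sq_mul_exp_le`: `V'(r)² e^{−V(r)/T} ≤ (6 + 8β) · 2T² e^{1/T}` — the junction Boltzmann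
  factor of the device's Gibbs density tames the junction force (`V ≥ 0` grows faster than `V'²`);
* `lintegral_weight_comp_restrictLeft_mul_gibbsDensity_le`: the weighted Tonelli bound
  `∫ w(r_J) F(π_N x) e^{−H_{N+M}/T} dx ≤ C · Z_M · ∫ F e^{−H_N/T}` for any weight with `w e^{−V/T} ≤ C`
  (the energy splits as `H_N + H_M + V(r_J)` across the junction bond — `hamiltonian_glue` of the landed
  `…StubTerminationLocalityAux4`, whose unweighted bound is the case `w = 1`);
* `memLp_junctionForce_mul_comp_restrictLeft` (registered as `helper_terminationJunctionLift`): for a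
  continuous `Φ ∈ L²(μ_T^{(N)})`, `V'(r_J) · Φ ∘ π_N ∈ L²(μ_T^{(N+M)})`.

Fixed-`N` statements (constants not uniform in `N, M`); folklore; nothing is taken as a named fact.
-/

noncomputable section

open MeasureTheory Filter Topology ProbabilityTheory
open scoped ContDiff NNReal ENNReal
open Literature.MathematicalPhysics.KineticTheory.HeatConduction
open Summit.AtomisticToContinuum.FouriersLaw.Theorems.SuperadditiveResistance.TerminationLocality
  (glue BlockData measurePreserving_glue restrictLeft_glue hamiltonian_glue)
open Summit.AtomisticToContinuum.FouriersLaw.Theorems.SuperadditiveResistance.Kubo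
  (integrable_sq_mul_gibbsDensity memLp_of_integrable_sq_mul_gibbsDensity)

namespace Summit.AtomisticToContinuum.FouriersLaw.Cruxes.SuperadditiveResistance.ThermaliseThenCutProbeInsertion

/-! ## The junction force is tamed by the junction Boltzmann factor -/

section JunctionForce

variable {ω₂ lam β : ℝ}

/-- The interaction potential of the pinned chain. -/
theorem pinnedChain_V_apply (ω₂ lam β γ r : ℝ) :
    (pinnedChain ω₂ lam β γ).V r = r ^ 2 / 2 + β * r ^ 4 / 4 := rfl

/-- `V'(r)² ≤ (6 + 8β)(1 + V(r))²` (`β ≥ 0`). -/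
theorem junctionForce_sq_le (hβ : 0 ≤ β) (r : ℝ) :
    (r + β * r ^ 3) ^ 2 ≤ (6 + 8 * β) * (1 + (r ^ 2 / 2 + β * r ^ 4 / 4)) ^ 2 := by
  have hs : 0 ≤ r ^ 2 := sq_nonneg r
  set s := r ^ 2 with hs_def
  have e1 : (r + β * r ^ 3) ^ 2 = s * (1 + β * s) ^ 2 := by rw [hs_def]; ring
  have e2 : r ^ 4 = s ^ 2 := by rw [hs_def]; ring
  rw [e1, e2]
  nlinarith [mul_nonneg hβ hs, mul_nonneg (mul_nonneg hβ hs) hs, mul_nonneg (mul_nonneg hβ hβ) (mul_nonneg hs hs),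
    mul_nonneg (mul_nonneg (mul_nonneg hβ hβ) (mul_nonneg hs hs)) hs, sq_nonneg s,
    mul_nonneg (mul_nonneg hβ hs) (mul_nonneg hs hs), mul_nonneg (mul_nonneg (mul_nonneg hβ hβ) hs) (mul_nonneg hs (mul_nonneg hs hs))]

/-- **The junction force is tamed by the junction Boltzmann factor**:
`V'(r)² e^{−V(r)/T} ≤ (6 + 8β) · 2T² e^{1/T}` for all `r` (`β ≥ 0`, `T > 0`). -/
theorem junctionForce_sq_mul_exp_le (hβ : 0 ≤ β) {T : ℝ} (hT : 0 < T) (γ r : ℝ) :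
    (r + β * r ^ 3) ^ 2 * Real.exp (-(pinnedChain ω₂ lam β γ).V r / T) ≤
      (6 + 8 * β) * (2 * Real.exp (1 / T) / (1 / T) ^ 2) := by
  rw [pinnedChain_V_apply]
  set v := r ^ 2 / 2 + β * r ^ 4 / 4 with hv
  have hv0 : 0 ≤ v := by rw [hv]; positivity
  have h1 := junctionForce_sq_le hβ r
  have h2 : (1 + v) ^ 2 ≤ 2 * Real.exp (1 / T) / (1 / T) ^ 2 * Real.exp (1 / T * v) :=
    one_add_sq_le_exp hv0 (by positivity)
  have hexp : Real.exp (1 / T * v) * Real.exp (-v / T) = 1 := by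
    rw [← Real.exp_add]; rw [show 1 / T * v + -v / T = 0 by ring]; exact Real.exp_zero
  have hE : 0 < Real.exp (-v / T) := Real.exp_pos _
  calc (r + β * r ^ 3) ^ 2 * Real.exp (-v / T)
      ≤ (6 + 8 * β) * (1 + v) ^ 2 * Real.exp (-v / T) := mul_le_mul_of_nonneg_right h1 hE.le
    _ ≤ (6 + 8 * β) * (2 * Real.exp (1 / T) / (1 / T) ^ 2 * Real.exp (1 / T * v)) * Real.exp (-v / T) :=
        mul_le_mul_of_nonneg_right (mul_le_mul_of_nonneg_left h2 (by positivity)) hE.le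
    _ = (6 + 8 * β) * (2 * Real.exp (1 / T) / (1 / T) ^ 2) := by
        rw [show (6 + 8 * β) * (2 * Real.exp (1 / T) / (1 / T) ^ 2 * Real.exp (1 / T * v)) * Real.exp (-v / T) =
          (6 + 8 * β) * (2 * Real.exp (1 / T) / (1 / T) ^ 2) * (Real.exp (1 / T * v) * Real.exp (-v / T)) by ring,
          hexp, mul_one]

end JunctionForce

/-! ## A weighted left-block marginal bound and `L²` lifting across the junction -/

section Marginal

variable {ω₂ lam β : ℝ} {N M : ℕ}

-- adapted from Theorems/JunctionLocalitySuperadditiveResistanceStubTerminationLocalityAux4.lean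
-- (`lintegral_comp_restrictLeft_mul_gibbsDensity_le`: the case `w = 1`, `C = 1`)
/-- **Weighted Tonelli bound for the left-block marginal of the device's Gibbs density.** For a
measurable weight `w ≥ 0` of the junction stretch `r_J = q_N − q_{N−1}` tamed by the junction
Boltzmann factor, `w(r) e^{−V(r)/T} ≤ C`, and measurable `F ≥ 0` on the left block:
`∫ w(r_J) F(π_N x) e^{−H_{N+M}(x)/T} dx ≤ C · Z_M(T) · ∫ F e^{−H_N/T}` (`N, M ≥ 1`; the energy splits
as `H_{N+M} = H_N + H_M + V(r_J)` across the junction bond). -/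
theorem lintegral_weight_comp_restrictLeft_mul_gibbsDensity_le (ω₂ lam β γ : ℝ)
    (hN : 1 ≤ N) (hM : 1 ≤ M) (T : ℝ) {w : ℝ → ℝ} (hwm : Measurable w) (hw0 : ∀ r, 0 ≤ w r)
    {C : ℝ} (hC : ∀ r, w r * Real.exp (-(pinnedChain ω₂ lam β γ).V r / T) ≤ C)
    {F : PhaseSpace N → ℝ≥0∞} (hF : Measurable F) :
    ∫⁻ x : PhaseSpace (N + M), ENNReal.ofReal (w (x.1 ⟨N, by omega⟩ - x.1 ⟨N - 1, by omega⟩)) *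
        (F (x.1 ∘ Fin.castAdd M, x.2 ∘ Fin.castAdd M) *
          ENNReal.ofReal ((pinnedChain ω₂ lam β γ).gibbsDensity (N + M) T x)) ≤
      ENNReal.ofReal C * ((pinnedChain ω₂ lam β γ).partitionFunction M T *
        ∫⁻ y : PhaseSpace N, F y * ENNReal.ofReal ((pinnedChain ω₂ lam β γ).gibbsDensity N T y)) := by
  set P := pinnedChain ω₂ lam β γ with hP
  have hρc : ∀ L, Continuous (P.gibbsDensity L T) := fun L =>
    pinnedChain_continuous_gibbsDensity ω₂ lam β γ L T
  have hρm : ∀ L, Measurable fun x => ENNReal.ofReal (P.gibbsDensity L T x) := fun L =>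
    (hρc L).measurable.ennreal_ofReal
  set G : PhaseSpace (N + M) → ℝ≥0∞ := fun x =>
    ENNReal.ofReal (w (x.1 ⟨N, by omega⟩ - x.1 ⟨N - 1, by omega⟩)) *
      (F (x.1 ∘ Fin.castAdd M, x.2 ∘ Fin.castAdd M) * ENNReal.ofReal (P.gibbsDensity (N + M) T x))
    with hG
  have hπ : Measurable fun x : PhaseSpace (N + M) =>
      ((x.1 ∘ Fin.castAdd M, x.2 ∘ Fin.castAdd M) : PhaseSpace N) := by
    refine Measurable.prodMk ?_ ?_
    · exact measurable_pi_lambda _ fun i => (measurable_pi_apply _).comp measurable_fst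
    · exact measurable_pi_lambda _ fun i => (measurable_pi_apply _).comp measurable_snd
  have hrm : Measurable fun x : PhaseSpace (N + M) => x.1 ⟨N, by omega⟩ - x.1 ⟨N - 1, by omega⟩ :=
    ((measurable_pi_apply (⟨N, by omega⟩ : Fin (N + M))).comp measurable_fst).sub
      ((measurable_pi_apply (⟨N - 1, by omega⟩ : Fin (N + M))).comp measurable_fst)
  have hwx : Measurable fun x : PhaseSpace (N + M) =>
      ENNReal.ofReal (w (x.1 ⟨N, by omega⟩ - x.1 ⟨N - 1, by omega⟩)) :=
    (hwm.comp hrm).ennreal_ofReal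
  have hGm : Measurable G := hwx.mul ((hF.comp hπ).mul (hρm _))
  set A : PhaseSpace N → ℝ≥0∞ := fun y => F y * ENNReal.ofReal (P.gibbsDensity N T y) with hA
  set B : PhaseSpace M → ℝ≥0∞ := fun z => ENNReal.ofReal (P.gibbsDensity M T z) with hB
  have hAm : Measurable A := hF.mul (hρm _)
  have hBm : Measurable B := hρm _
  -- change of variables along the gluing map
  have h1 : ∫⁻ x, G x = ∫⁻ v, G (glue N M v)
      ∂((((volume : Measure (Fin N → ℝ)).prod (volume : Measure (Fin M → ℝ))).prod
        ((volume : Measure (Fin N → ℝ)).prod (volume : Measure (Fin M → ℝ))))) :=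
    (measurePreserving_glue.lintegral_comp hGm).symm
  -- pointwise domination on block data
  have h2 : ∀ v : BlockData N M, G (glue N M v) ≤ ENNReal.ofReal C * (A (v.1.1, v.2.1) * B (v.1.2, v.2.2)) := by
    intro v
    have eN : (glue N M v).1 ⟨N, by omega⟩ = v.1.2 ⟨0, by omega⟩ := by
      have : (⟨N, by omega⟩ : Fin (N + M)) = Fin.natAdd N ⟨0, by omega⟩ := Fin.ext (by simp)
      rw [this]
      exact Fin.append_right v.1.1 v.1.2 ⟨0, by omega⟩
    have eN1 : (glue N M v).1 ⟨N - 1, by omega⟩ = v.1.1 ⟨N - 1, by omega⟩ := by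
      have : (⟨N - 1, by omega⟩ : Fin (N + M)) = Fin.castAdd M ⟨N - 1, by omega⟩ := Fin.ext (by simp)
      rw [this]
      exact Fin.append_left v.1.1 v.1.2 ⟨N - 1, by omega⟩
    set r := v.1.2 ⟨0, by omega⟩ - v.1.1 ⟨N - 1, by omega⟩ with hr
    have hρ : P.gibbsDensity (N + M) T (glue N M v) =
        Real.exp (-P.V r / T) * (P.gibbsDensity N T (v.1.1, v.2.1) * P.gibbsDensity M T (v.1.2, v.2.2)) := by
      simp only [OscillatorChain.gibbsDensity, ← Real.exp_add]
      rw [hamiltonian_glue _ hN hM]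
      congr 1
      rw [hr]
      ring
    simp only [hG, hA, hB]
    rw [restrictLeft_glue, eN, eN1, hρ, ENNReal.ofReal_mul (Real.exp_pos _).le,
      ENNReal.ofReal_mul (P.gibbsDensity_pos N T _).le]
    have hwC : ENNReal.ofReal (w r) * ENNReal.ofReal (Real.exp (-P.V r / T)) ≤ ENNReal.ofReal C := by
      rw [← ENNReal.ofReal_mul (hw0 r)]
      exact ENNReal.ofReal_le_ofReal (hC r)
    calc ENNReal.ofReal (w r) * (F (v.1.1, v.2.1) * (ENNReal.ofReal (Real.exp (-P.V r / T)) *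
          (ENNReal.ofReal (P.gibbsDensity N T (v.1.1, v.2.1)) *
            ENNReal.ofReal (P.gibbsDensity M T (v.1.2, v.2.2)))))
        = (ENNReal.ofReal (w r) * ENNReal.ofReal (Real.exp (-P.V r / T))) *
            (F (v.1.1, v.2.1) * ENNReal.ofReal (P.gibbsDensity N T (v.1.1, v.2.1)) *
              ENNReal.ofReal (P.gibbsDensity M T (v.1.2, v.2.2))) := by ring
      _ ≤ ENNReal.ofReal C * (F (v.1.1, v.2.1) * ENNReal.ofReal (P.gibbsDensity N T (v.1.1, v.2.1)) *
              ENNReal.ofReal (P.gibbsDensity M T (v.1.2, v.2.2))) := mul_le_mul' hwC le_rfl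
  -- Tonelli on the block data
  have h3 : ∫⁻ v, A (v.1.1, v.2.1) * B (v.1.2, v.2.2)
      ∂((((volume : Measure (Fin N → ℝ)).prod (volume : Measure (Fin M → ℝ))).prod
        ((volume : Measure (Fin N → ℝ)).prod (volume : Measure (Fin M → ℝ))))) =
      (∫⁻ y, A y) * ∫⁻ z, B z := by
    have hH : Measurable fun v : BlockData N M => A (v.1.1, v.2.1) * B (v.1.2, v.2.2) := by
      refine Measurable.mul (hAm.comp ?_) (hBm.comp ?_)
      · exact (measurable_fst.comp measurable_fst).prodMk (measurable_fst.comp measurable_snd)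
      · exact (measurable_snd.comp measurable_fst).prodMk (measurable_snd.comp measurable_snd)
    rw [lintegral_prod _ hH.aemeasurable]
    have hin : ∀ qq : (Fin N → ℝ) × (Fin M → ℝ),
        ∫⁻ pp : (Fin N → ℝ) × (Fin M → ℝ), A (qq.1, pp.1) * B (qq.2, pp.2)
          ∂((volume : Measure (Fin N → ℝ)).prod (volume : Measure (Fin M → ℝ))) =
        (∫⁻ pN, A (qq.1, pN)) * ∫⁻ pM, B (qq.2, pM) := by
      intro qq
      exact lintegral_prod_mul (hAm.comp (measurable_const.prodMk measurable_id)).aemeasurable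
        (hBm.comp (measurable_const.prodMk measurable_id)).aemeasurable
    simp_rw [hin]
    have ha : Measurable fun qN : Fin N → ℝ => ∫⁻ pN, A (qN, pN) := hAm.lintegral_prod_right'
    have hb : Measurable fun qM : Fin M → ℝ => ∫⁻ pM, B (qM, pM) := hBm.lintegral_prod_right'
    rw [lintegral_prod_mul ha.aemeasurable hb.aemeasurable]
    congr 1
    · exact (lintegral_prod A hAm.aemeasurable).symm
    · exact (lintegral_prod B hBm.aemeasurable).symm
  have hABm : Measurable fun v : BlockData N M => A (v.1.1, v.2.1) * B (v.1.2, v.2.2) := by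
    refine Measurable.mul (hAm.comp ?_) (hBm.comp ?_)
    · exact (measurable_fst.comp measurable_fst).prodMk (measurable_fst.comp measurable_snd)
    · exact (measurable_snd.comp measurable_fst).prodMk (measurable_snd.comp measurable_snd)
  calc ∫⁻ x, G x = _ := h1
    _ ≤ ∫⁻ v, ENNReal.ofReal C * (A (v.1.1, v.2.1) * B (v.1.2, v.2.2)) ∂_ := lintegral_mono h2
    _ = ENNReal.ofReal C * ((∫⁻ y, A y) * ∫⁻ z, B z) := by rw [lintegral_const_mul _ hABm, h3]
    _ = ENNReal.ofReal C * (P.partitionFunction M T * ∫⁻ y, A y) := by rw [mul_comm (∫⁻ y, A y)]; rfl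

/-- **`L²` lifting across the junction.** For the pinned chain (`ω₂ > 0`, `lam, β ≥ 0`, `T > 0`,
`N, M ≥ 1`) and a continuous `Φ ∈ L²(μ_T^{(N)})` on the left block, the junction-force multiple
`V'(q_N − q_{N−1}) · Φ ∘ π_N` (`V'(r) = r + βr³`) lies in `L²(μ_T^{(N+M)})`: the unbounded polynomial
weight is absorbed by the junction Boltzmann factor `e^{−V(r_J)/T}` of the device's Gibbs density. -/
theorem memLp_junctionForce_mul_comp_restrictLeft (hω : 0 < ω₂) (hl : 0 ≤ lam) (hβ : 0 ≤ β) (γ : ℝ)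
    (hN : 1 ≤ N) (hM : 1 ≤ M) {T : ℝ} (hT : 0 < T) {Φ : PhaseSpace N → ℝ} (hΦc : Continuous Φ)
    (hΦ : MemLp Φ 2 ((pinnedChain ω₂ lam β γ).gibbsMeasure N T)) :
    MemLp (fun x : PhaseSpace (N + M) =>
        ((x.1 ⟨N, by omega⟩ - x.1 ⟨N - 1, by omega⟩) +
            β * (x.1 ⟨N, by omega⟩ - x.1 ⟨N - 1, by omega⟩) ^ 3) *
          Φ (x.1 ∘ Fin.castAdd M, x.2 ∘ Fin.castAdd M)) 2
      ((pinnedChain ω₂ lam β γ).gibbsMeasure (N + M) T) := by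
  set P := pinnedChain ω₂ lam β γ with hP
  have hπc : Continuous fun x : PhaseSpace (N + M) =>
      ((x.1 ∘ Fin.castAdd M, x.2 ∘ Fin.castAdd M) : PhaseSpace N) := by
    refine Continuous.prodMk ?_ ?_
    · exact continuous_pi fun i => (continuous_apply _).comp continuous_fst
    · exact continuous_pi fun i => (continuous_apply _).comp continuous_snd
  have hrc : Continuous fun x : PhaseSpace (N + M) => x.1 ⟨N, by omega⟩ - x.1 ⟨N - 1, by omega⟩ :=
    ((continuous_apply _).comp continuous_fst).sub ((continuous_apply _).comp continuous_fst)
  have hfc : Continuous fun x : PhaseSpace (N + M) =>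
      ((x.1 ⟨N, by omega⟩ - x.1 ⟨N - 1, by omega⟩) +
          β * (x.1 ⟨N, by omega⟩ - x.1 ⟨N - 1, by omega⟩) ^ 3) *
        Φ (x.1 ∘ Fin.castAdd M, x.2 ∘ Fin.castAdd M) :=
    (hrc.add (continuous_const.mul (hrc.pow 3))).mul (hΦc.comp hπc)
  refine memLp_of_integrable_sq_mul_gibbsDensity hω hl hβ γ (N + M) hT hfc ?_
  have hρc : Continuous (P.gibbsDensity (N + M) T) := pinnedChain_continuous_gibbsDensity ω₂ lam β γ _ T
  refine ⟨((hfc.pow 2).mul hρc).aestronglyMeasurable, ?_⟩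
  rw [hasFiniteIntegral_iff_ofReal (ae_of_all _ fun x =>
    mul_nonneg (sq_nonneg _) (P.gibbsDensity_pos (N + M) T x).le)]
  -- the weighted marginal bound with `w = V'²`, `F = Φ²`
  set C : ℝ := (6 + 8 * β) * (2 * Real.exp (1 / T) / (1 / T) ^ 2) with hCdef
  have hwm : Measurable fun r : ℝ => (r + β * r ^ 3) ^ 2 :=
    ((measurable_id.add (measurable_const.mul (measurable_id.pow_const 3))).pow_const 2)
  have hFm : Measurable fun y : PhaseSpace N => ENNReal.ofReal (Φ y ^ 2) :=
    (hΦc.measurable.pow_const 2).ennreal_ofReal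
  have key := lintegral_weight_comp_restrictLeft_mul_gibbsDensity_le ω₂ lam β γ hN hM T (M := M) hwm
    (fun r => sq_nonneg _) (fun r => junctionForce_sq_mul_exp_le hβ hT γ r) hFm
  have e : ∀ x : PhaseSpace (N + M),
      ENNReal.ofReal ((((x.1 ⟨N, by omega⟩ - x.1 ⟨N - 1, by omega⟩) +
            β * (x.1 ⟨N, by omega⟩ - x.1 ⟨N - 1, by omega⟩) ^ 3) *
          Φ (x.1 ∘ Fin.castAdd M, x.2 ∘ Fin.castAdd M)) ^ 2 * P.gibbsDensity (N + M) T x) =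
        ENNReal.ofReal (((x.1 ⟨N, by omega⟩ - x.1 ⟨N - 1, by omega⟩) +
            β * (x.1 ⟨N, by omega⟩ - x.1 ⟨N - 1, by omega⟩) ^ 3) ^ 2) *
          (ENNReal.ofReal (Φ (x.1 ∘ Fin.castAdd M, x.2 ∘ Fin.castAdd M) ^ 2) *
            ENNReal.ofReal (P.gibbsDensity (N + M) T x)) := by
    intro x
    rw [← ENNReal.ofReal_mul (sq_nonneg _), ← ENNReal.ofReal_mul (sq_nonneg _)]
    congr 1
    ring
  simp_rw [e]
  refine lt_of_le_of_lt key (ENNReal.mul_lt_top ENNReal.ofReal_lt_top (ENNReal.mul_lt_top ?_ ?_))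
  · exact lt_top_iff_ne_top.mpr (P.partitionFunction_ne_top (pinnedChain_integrable_gibbsDensity hω hl hβ γ M hT))
  · have hI := integrable_sq_mul_gibbsDensity hω hl hβ γ N hT hΦ
    have h2 := hI.lintegral_lt_top
    refine lt_of_le_of_lt (le_of_eq ?_) h2
    refine lintegral_congr fun y => ?_
    rw [← ENNReal.ofReal_mul (sq_nonneg _)]

end Marginal

/-- Registered helper sub-goal `helper_terminationJunctionLift` (= `memLp_junctionForce_mul_comp_restrictLeft`
in stub form): `L²` observables of the bare left block, multiplied by the junction force, are `L²`
observables of the device. -/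
theorem helper_terminationJunctionLift : ∀ {ω₂ lam β : ℝ}, 0 < ω₂ → 0 ≤ lam → 0 ≤ β → ∀ (γ : ℝ) {N M : ℕ} (hN : 1 ≤ N) (hM : 1 ≤ M) {T : ℝ}, 0 < T → ∀ {Φ : PhaseSpace N → ℝ}, Continuous Φ → MemLp Φ 2 ((pinnedChain ω₂ lam β γ).gibbsMeasure N T) → MemLp (fun x : PhaseSpace (N + M) => ((x.1 ⟨N, by omega⟩ - x.1 ⟨N - 1, by omega⟩) + β * (x.1 ⟨N, by omega⟩ - x.1 ⟨N - 1, by omega⟩) ^ 3) * Φ (x.1 ∘ Fin.castAdd M, x.2 ∘ Fin.castAdd M)) 2 ((pinnedChain ω₂ lam β γ).gibbsMeasure (N + M) T) :=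
  fun hω hl hβ γ _ _ hN hM _ hT _ hΦc hΦ => memLp_junctionForce_mul_comp_restrictLeft hω hl hβ γ hN hM hT hΦc hΦ

end Summit.AtomisticToContinuum.FouriersLaw.Cruxes.SuperadditiveResistance.ThermaliseThenCutProbeInsertion

end
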